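import Summits.AnomalousDissipation.AnomalousDissipation.Theses.KolmogorovPincer
import Summits.AnomalousDissipation.AnomalousDissipation.Theorems.KolmogorovPincerBesovSignalMeasurableTG
import Literature.Analysis.FluidPDE.LerayHopfSpectralMeasurability
import Literature.Analysis.FluidPDE.LerayHopfTimeSliceTorus
import Literature.Analysis.FunctionSpaces.BesovDifference
import Literature.Analysis.FunctionSpaces.BesovSliceMeasurability
import Literature.Analysis.FunctionSpaces.FlatTorus

/-!
# Support item `KolmogorovPincer.LagSignalMeasurableTG` (stmt-AnomalousDissipation-33461), proved

Route `KolmogorovPincer` (decomp-ad cell): the S–M JUNK-NEUTRALISER of the two halves of the KOLMOGOROV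
LAG CUT of the Y-jaw `KolmogorovCeilingTG` (32240 = `SubKolmogorovCeilingTG` 33458 ∧ `TaylorRangeCeilingTG`
33459, glue `LagCutGlue` 33460).  The Nikol'skii quotient sup `⨆_{h ≠ 0}` of the `(1/2, 8/3)` Besov
signal is restricted to the DISSIPATION-RANGE lags `‖h‖ < ν^{3/4}` (Kolmogorov length at unit injection)
resp. the TAYLOR/INERTIAL-RANGE lags `‖h‖ > ν^{3/4}/2` — an OPEN overlapping cover of `{h ≠ 0}`.  This
file: the restricted sup `eBesovSupOn s p v S` (node-internal bookkeeping; the tree texts of 33458 /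
33459 / 33461 are its unfoldings at `S = dissLags ν`, `inertLags ν`, definitionally; the cover algebra
lives with the glue in `Theorems/KolmogorovPincerLagCutGlue.lean`) and the measurability in time of both
restricted signals along every global Leray–Hopf solution on `T³`: on an OPEN lag set the
restricted sup of an `L^p` slice is a COUNTABLE sup over a dense sequence of lags (continuity of
`h ↦ ‖δ_h g‖_p`, tree `continuousAt_eDiffQuotient`), each slice quotient is jointly measurable (tree
`measurable_eDiffQuotient_slice`), and a.e. slice lies in `L^{8/3}` (tree
`KolmogorovPincerBesovSignalMeasurableTG.ae_memLp_of_isLerayHopfOn`, cited by name).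
Ported verbatim (by name against the route file, rev 11) from the decomp-ad lens-1 g15 node file
`KolmogorovLagCut.lean` v2 (`lagSignalMeasurableTG_holds`, kernel-checked there 2026-08-30, crit
«CLEARED»); landed by the cell's prover seat.  Nothing here proves the summit, the jaw or either half.
References: Frisch 1995 §7.1, §8.5.5 (Kolmogorov length); Triebel 1983 §2.5.12 (Nikol'skii spaces).
[folklore]
-/

set_option linter.dupNamespace false

noncomputable section

namespace Summit.AnomalousDissipation.AnomalousDissipation.Theorems.KolmogorovPincerLagSignalMeasurableTG

open scoped BigOperators Topology Classical MeasureTheory InnerProductSpace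
open Filter Set Function TopologicalSpace MeasureTheory
open scoped ENNReal
open Literature.Analysis.FunctionSpaces Literature.Analysis.FluidPDE
open Summit.AnomalousDissipation.AnomalousDissipation.Theses

section LagSets

/-- Restricted Nikol'skii–Besov sup: the quotient sup over lags `h ≠ 0`, `h ∈ S`. -/
noncomputable def eBesovSupOn (s : ℝ) (p : ℝ≥0∞) (v : UnitAddTorus (Fin 3) → EuclideanSpace ℝ (Fin 3))
    (S : Set (UnitAddTorus (Fin 3))) : ℝ≥0∞ :=
  ⨆ (h : UnitAddTorus (Fin 3)) (_ : h ≠ 0) (_ : h ∈ S), eDiffQuotient s p v volume h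

/-- Dissipation-range lags `‖h‖ < ν^{3/4}`. -/
def dissLags (ν : ℝ) : Set (UnitAddTorus (Fin 3)) := {h | ‖h‖ < ν ^ (3 / 4 : ℝ)}

/-- Taylor/inertial-range lags `‖h‖ > ν^{3/4}/2` (open; overlaps `dissLags` on one octave). -/
def inertLags (ν : ℝ) : Set (UnitAddTorus (Fin 3)) := {h | ν ^ (3 / 4 : ℝ) / 2 < ‖h‖}

/-- The dissipation-range lag set is open. -/
theorem isOpen_dissLags (ν : ℝ) : IsOpen (dissLags ν) := isOpen_lt continuous_norm continuous_const

/-- The Taylor/inertial-range lag set is open. -/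
theorem isOpen_inertLags (ν : ℝ) : IsOpen (inertLags ν) := isOpen_lt continuous_const continuous_norm

variable {s : ℝ} {p : ℝ≥0∞} {v : UnitAddTorus (Fin 3) → EuclideanSpace ℝ (Fin 3)}
  {S : Set (UnitAddTorus (Fin 3))}

/-- Each admissible quotient is below the restricted sup. -/
theorem eDiffQuotient_le_eBesovSupOn {h : UnitAddTorus (Fin 3)} (hh : h ≠ 0) (hS : h ∈ S) :
    eDiffQuotient s p v volume h ≤ eBesovSupOn s p v S :=
  le_iSup_of_le h (le_iSup_of_le hh (le_iSup_of_le hS le_rfl))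

end LagSets

section SliceMeasurability

variable {s : ℝ} {p : ℝ≥0∞} {S : Set (UnitAddTorus (Fin 3))}

/-- On an OPEN lag set the restricted sup of an `L^p` slice (`1 ≤ p < ∞`) is a countable sup over any
dense sequence of lags (continuity of `h ↦ ‖δ_h g‖_p`). -/
theorem eBesovSupOn_eq_iSup_seq (hS : IsOpen S) (hp : 1 ≤ p) (hp' : p ≠ ∞)
    {g : UnitAddTorus (Fin 3) → EuclideanSpace ℝ (Fin 3)} (hg : MemLp g p volume)
    {a : ℕ → UnitAddTorus (Fin 3)} (ha : DenseRange a) :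
    eBesovSupOn s p g S = ⨆ (n : ℕ) (_ : a n ≠ 0 ∧ a n ∈ S), eDiffQuotient s p g volume (a n) := by
  refine le_antisymm ?_ (iSup₂_le fun n hn => eDiffQuotient_le_eBesovSupOn hn.1 hn.2)
  refine iSup₂_le fun h₀ hh₀ => iSup_le fun hS₀ => le_of_forall_lt fun c hc => ?_
  have hcont := continuousAt_eDiffQuotient (μ := volume) (s := s) hp hp' hg hh₀
  have hev : ∀ᶠ h in 𝓝 h₀, c < eDiffQuotient s p g volume h ∧ (h ≠ 0 ∧ h ∈ S) := by
    have h1 : ∀ᶠ h in 𝓝 h₀, c < eDiffQuotient s p g volume h := hcont.eventually (lt_mem_nhds hc)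
    have h2 : ∀ᶠ h in 𝓝 h₀, h ∈ {h : UnitAddTorus (Fin 3) | h ≠ 0} ∩ S :=
      (isOpen_ne.inter hS).mem_nhds ⟨hh₀, hS₀⟩
    filter_upwards [h1, h2] with h hh hh2
    exact ⟨hh, hh2⟩
  obtain ⟨U, hU, hUo, hU₀⟩ := eventually_nhds_iff.1 hev
  obtain ⟨n, hn⟩ := ha.exists_mem_open hUo ⟨h₀, hU₀⟩
  exact lt_of_lt_of_le (hU _ hn).1
    (le_iSup₂ (f := fun n (_ : a n ≠ 0 ∧ a n ∈ S) => eDiffQuotient s p g volume (a n)) n (hU _ hn).2)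

/-- Restricted Besov sups of the slices of a jointly measurable field are a.e.-measurable in time
(open lag set; countable sup of measurable slice quotients). -/
theorem aemeasurable_eBesovSupOn_slice (hS : IsOpen S) {St : Set ℝ} (hp : 1 ≤ p) (hp' : p ≠ ∞)
    {u : ℝ → UnitAddTorus (Fin 3) → EuclideanSpace ℝ (Fin 3)}
    (hm : AEStronglyMeasurable (uncurry u) ((volume.restrict St).prod volume))
    (hu : ∀ᵐ t ∂(volume.restrict St), MemLp (u t) p volume) :
    AEMeasurable (fun t => eBesovSupOn s p (u t) S) (volume.restrict St) := by
  have hp0 : p ≠ 0 := (lt_of_lt_of_le zero_lt_one hp).ne'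
  set a : ℕ → UnitAddTorus (Fin 3) := TopologicalSpace.denseSeq (UnitAddTorus (Fin 3)) with ha_def
  have ha : DenseRange a := TopologicalSpace.denseRange_denseSeq _
  set U : ℝ × UnitAddTorus (Fin 3) → EuclideanSpace ℝ (Fin 3) := hm.mk (uncurry u) with hU_def
  have hU : StronglyMeasurable U := hm.stronglyMeasurable_mk
  have hae : ∀ᵐ t ∂(volume.restrict St), ∀ᵐ x ∂(volume : Measure (UnitAddTorus (Fin 3))),
      uncurry u (t, x) = U (t, x) :=
    Measure.ae_ae_of_ae_prod hm.ae_eq_mk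
  set Φ : ℝ → ℝ≥0∞ := fun t => ⨆ (n : ℕ) (_ : a n ≠ 0 ∧ a n ∈ S),
    eDiffQuotient s p (fun x => U (t, x)) volume (a n) with hΦ_def
  have hΦ : Measurable Φ :=
    Measurable.iSup fun n => Measurable.iSup_Prop _ (measurable_eDiffQuotient_slice hp0 hp' hU (a n))
  refine ⟨Φ, hΦ, ?_⟩
  filter_upwards [hae, hu] with t ht htp
  have hslice : u t =ᵐ[volume] fun x => U (t, x) := ht
  have hUp : MemLp (fun x => U (t, x)) p volume := htp.ae_eq hslice
  have hq : ∀ h, eDiffQuotient s p (u t) volume h = eDiffQuotient s p (fun x => U (t, x)) volume h := by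
    intro h
    simp only [eDiffQuotient]
    congr 1
    refine eLpNorm_congr_ae ?_
    have h1 : (u t ∘ fun x => x + h) =ᵐ[volume] ((fun x => U (t, x)) ∘ fun x => x + h) :=
      (measurePreserving_add_right volume h).quasiMeasurePreserving.ae_eq_comp hslice
    filter_upwards [hslice, h1] with x hx hx1
    simp only [Function.comp] at hx1
    rw [hx, hx1]
  calc eBesovSupOn s p (u t) S = eBesovSupOn s p (fun x => U (t, x)) S := by
        simp only [eBesovSupOn, hq]
    _ = Φ t := eBesovSupOn_eq_iSup_seq hS hp hp' hUp ha

/-- Along a global Leray–Hopf solution on `T³`: `t ↦ [u(t)]_{S}` restricted to an open lag set is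
a.e.-measurable on `(0,∞)` for `1 ≤ p ≤ 6`. -/
theorem aemeasurable_eBesovSupOn_of_isGlobalLerayHopf (hS : IsOpen S) {ν : ℝ}
    {F : ℝ → UnitAddTorus (Fin 3) → EuclideanSpace ℝ (Fin 3)}
    {u₀ : UnitAddTorus (Fin 3) → EuclideanSpace ℝ (Fin 3)}
    {u : ℝ → UnitAddTorus (Fin 3) → EuclideanSpace ℝ (Fin 3)} (hu : Torus.IsGlobalLerayHopf ν F u₀ u)
    (s : ℝ) (hp : 1 ≤ p) (hp6 : p ≤ 6) :
    AEMeasurable (fun t => eBesovSupOn s p (u t) S) (volume.restrict (Set.Ioi (0 : ℝ))) := by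
  rw [Torus.Ioi_zero_eq_iUnion_Ioo_nat, aemeasurable_iUnion_iff]
  intro n
  rcases Nat.eq_zero_or_pos n with hn | hn
  · subst hn; simp
  · have hLH := hu n (by exact_mod_cast hn)
    have hp' : p ≠ ∞ := ne_top_of_le_ne_top (by norm_num) hp6
    exact aemeasurable_eBesovSupOn_slice hS hp hp' hLH.aestronglyMeasurable_uncurry
      (KolmogorovPincerBesovSignalMeasurableTG.ae_memLp_of_isLerayHopfOn hLH hp6)

end SliceMeasurability

/-- **Route decl `KolmogorovPincer.LagSignalMeasurableTG` (stmt-AnomalousDissipation-33461), proved.**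
Both lag sets are open, so both restricted `(1/2, 8/3)` signals are a.e.-strongly measurable in time on
`(0, ∞)` along every global Leray–Hopf solution from rest at the Taylor–Green force (in fact along any
global Leray–Hopf solution on `T³`; the force and the datum are not used). [folklore] -/
theorem kolmogorovPincer_lagSignalMeasurableTG : KolmogorovPincer.LagSignalMeasurableTG := by
  intro f _ ν _ u hu
  have h1 : (1 : ℝ≥0∞) ≤ 8 / 3 := by
    rw [ENNReal.le_div_iff_mul_le (by norm_num) (by norm_num)]; norm_num
  have h2 : (8 / 3 : ℝ≥0∞) ≤ 6 := by
    rw [ENNReal.div_le_iff_le_mul (by norm_num) (by norm_num)]; norm_num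
  have hd := aemeasurable_eBesovSupOn_of_isGlobalLerayHopf (isOpen_dissLags ν) hu (1 / 2 : ℝ) h1 h2
  have hi := aemeasurable_eBesovSupOn_of_isGlobalLerayHopf (isOpen_inertLags ν) hu (1 / 2 : ℝ) h1 h2
  exact ⟨(hd.pow_const 2).ennreal_toReal.aestronglyMeasurable,
    (hi.pow_const 2).ennreal_toReal.aestronglyMeasurable⟩

end Summit.AnomalousDissipation.AnomalousDissipation.Theorems.KolmogorovPincerLagSignalMeasurableTG
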